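import Literature.MathematicalPhysics.QuantumFieldTheory.Balaban1983to89.B13Sect1Statements
import Literature.MathematicalPhysics.QuantumFieldTheory.Balaban1983to89.B13

/-!
# `Balaban1983to89.B13Carve27Sect1LocalizationsHyp` — [Balaban1988RG2Cluster] pp. 1–7 [PDF 1–7]: the Introduction and
# Sect. 1 «Localizations and Bounds of Terms in the Fluctuation Field Action», part 1, (1.1)–(1.25):
# THE HYPOTHESIS-FORM BUNDLE OF CARVING BLOCK 27, keyed to `B12.Construction` and the [13]-carriers of `B13Sect1Statements`

statement-level skeleton of published theorems with citation tags; proofs where landed; nothing here is a claim about the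
Yang–Mills mass gap

SOURCE.  T. Bałaban, *Renormalization group approach to lattice gauge field theories. II. Cluster expansions*, Commun. Math.
Phys. **116** (1988) 1–22, doi:10.1007/bf01239022 [`Balaban1988RG2Cluster`] (cell paper "B13" = [II] of the later papers; its
[I] = [Balaban1987RG1] = cell B12; a numeric reference [n] means entry [n] of [I]'s list: [13] = [Balaban1985BackgroundPropagators]
= B9, [15] = [Balaban1985Variational] = B11; held `paper:balaban1988-cmp116-rg-ii-cluster`, journal page = PDF page).  Pages 1–7
were read for this file on the text layer (`lit read … --pages 1-8`; line numbers «p000N.txt:Ln» below) and on the page render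
`run/shared/lean/pub/pub-balaban/b2b-balaban-ref1/pages/1988-cmp116-rg-II-cluster/…-p005-x2.png` ((1.11)–(1.14) and the
Proposition-4 sentence); every display quoted below is quoted from the render-checked verbatim docstrings of the cited in-tree
modules (`B13Sect1Statements`, `B13Contraction113`, `B13Sect1Arith`, `B13Eq117Hk`, `B13Eq119BPrime`, `B13Eq111SDecoupling`,
`B13WalkCubes111`, `B13MayerDecoupling`).  STATUS of the source: published, refereed; the series' end statement is a CLAIM UNDER
ADJUDICATION by the audit cell `pub-balaban` — see `…B13`'s module docstring.

WHY THIS FILE (cell `lit-balaban`, P6 CARVING FAN of D-0154 (3b); seat `lit-balaban-carve-02` g4, block 27 claimed under the cell lead's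
RULING #8, `run/shared/lean/pub/lit-balaban/carve/STATUS.md` 2026-08-28T08:01:01Z, after block 34 `B14Carve34Sect2ThmsHyp` landed and
was refereed; block row 27 of `carve/BLOCKS-21-30.md` = `carve/CARVE-LIST.md` § Block 27; rules `carve/CARVE-RULES.md` + RULING #9
(standing-smallness binders displayed); KEY item `stmt-QuantumFields-20543` (K2⁷ `EndpointGivenBR13SepCoPH`, the [B12]∕[B13] node whose
conclusion is `DagBinding.EndpointExistence (…).C.toB12` over a `B12.Construction`), also-feeds `stmt-QuantumFields-20544`).  The block is
the Introduction (the paper's only theorem-level claim: it completes the proof of Theorem 3 of [I]) and the first half of Sect. 1 — the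
localization of the nonlocal terms of the fluctuation-field action by s-decoupled random-walk expansions, (1.1)–(1.25): definitions,
by-reference inputs from [13]∕[15], and lemma-level estimates.  At statement level this stretch is IN THE TREE (cell SKELETON: 29 rows —
14 proved-existing, 7 typed, 6 typed-existing, 2 proved; 480 in-tree declarations in 112 files cite a locator in the range; CARVE-LIST
§ Block 27) — so, by the fan's rule «IN TREE = CITE, NEVER RESTATE» (CARVE-RULES §2.3), this file (a) RESTATES NOTHING: every printed
statement of the block that has a declaration is cited BY NAME below (table + census); (b) finds, after a sentence-by-sentence census of
pp. 1–7 against the tree, NO printed statement of the block without an in-tree home — the residual is EMPTY (every unnumbered claim is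
either PROVED on the tree's carriers, or the displayed hypothesis of a proved scheme, or a quoted by-reference input of [13]∕[15] typed by
name); (c) conjoins the block's HYPOTHESIS-FORM printed statements BY NAME — the Introduction's claim (`B13.SmallFieldStep`), (1.6)–(1.7)
(`B13Sect1Statements.Eq16_17`) and the p. 7 analyticity-domain sentence (`B13Sect1Statements.OnDomain7`) — into ONE bundle `Hyp` a node
prover takes as `(h : Hyp C E U A Cw cw M₁ δ₀ D Uc Analytic T loc α₀ α₁ β)`, with the bookkeeping a consumer wants (§2): [I] Theorem 3's
innermost clause along the windowed runs from the Introduction's claim and the base (`B13.indAss_all`), the common domain of p. 7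
(`B13Sect1Statements.commonDomain7_of_onDomain`), the projections.

## The block's SKELETON rows → the in-tree declarations this file CITES (never restates)

(module prefix `…Balaban1983to89.` dropped; «H» = hypothesis-form `Prop`, «T» = theorem, «D» = definition∕structure with body)

| row | print | in tree | used here |
|---|---|---|---|
| B13.Main | abstract p. 1 «It is proved that the terms of the expansion satisfy the inductive assumptions. This completes the construction of the sequence of effective actions in the small field approximation»; p. 1 «We prove also that terms of this expansion satisfy the inductive assumptions formulated in the first paper. Thus we complete the proof of Theorem 3 of that paper»; p. 22 | H `B13.SmallFieldStep D K γ` (over `B12.RunData`; T `B13.indAss_all`, `B13.thm3_inner_of_step`, `B13.smallFieldStep_of_parts`; D `B13.Deliverables` with T `B13.deliverables_of_chain`); H `B12.Thm3Printed` ([I] Thm 3); `Dag.B13_main`, T `DagBinding.smallField_of_B13step` | field `Hyp.main`; `Hyp.indAssAll_of_base` |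
| B13.R | the restrictions on constants of pp. 5–7 («for ε₂ satisfying 4C₂B₀e^{16κ₁}ε₂ ≦ 1», «The last inequality holds if 4C₄B₀²e^{32κ₁}ε₃ ≦ 1», «we assume that 2B₀e^{16κ₁}ε₃ ≦ ε₂», «g_k∣B∣ < ε₁», «if e^{32κ₁}ε₁ is smaller than an absolute constant. This constant can be easily obtained by inspection of all the above conditions», «We assume that 4B₀C₁e^{16κ₁}ε₁ ≦ ¼α₂», «for δ₁M ≧ κ₁») | D `B13.Consts`; the cell census R1–R9 as DISPLAYED hypotheses of T `B13Sect1Arith.selfmap_113`, `two_eps2_114`, `chain_115`, `chain_116`, `C₁_le_120`, `radius_122_R7`, ★ `B13Sect1Arith.inspection_121` and `B13Contraction113.inspection_121_contraction` (the «inspection» sentence PROVED: one absolute constant 1∕(B₀²C₁·max{…}) implies R2–R4, with the undisplayed contraction conditions, cell GAPS G-B13-02a); H `B13Bound143.R12` (p. 16, block 29) | cited |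
| B13.Eq1.1 | (1.1) p. 2 «Substituting 𝐀 = (tζ̃_□ + t_□ζ_□)𝐇_k(B′) (1.1) we introduce, through the function 𝐇_k(B′), a dependence on 𝐔, 𝐉, B on the whole lattice» | D `B13Sect1Statements.A11`, `A11Hk` with T `A11_eq_apply`, `norm_A11_le`, `norm_A11Hk_le`, `analyticOnNhd_A11Hk` | cited |
| B13.Eq1.2 ∕ B13.Eq1.17 | (1.2) p. 2 = (1.17) p. 6, 𝐇_k(B′) = H₀B′ + 𝐀₀ − HD(H₀B′ + 𝐀₀) («By the results of Sect. G [15]») | D `B13Eq117Hk.Hk`, `xArg` with T `Hk_def`, `Hk_eq_xArg`, `Hk_eq_changeOfVariables`, `analyticOnNhd_Hk` | cited |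
| B13.Eq1.3 ∕ B13.Eq1.4 ∕ B13.Eq1.13 ∕ B13.Eq1.14 ∕ B13.Eq1.15 | (1.3)–(1.4) p. 2 (the equations for D and 𝐀₀); (1.13)–(1.14) p. 5 («maps the domain {X : ∣X∣ < 4C₂ε₂²} into itself. We prove similarly that it is contractive on this domain, hence the fixed point is an analytic function of A′, s(Y₀), bounded by 4C₂ε₂². Because ε₂ can be chosen arbitrarily close to ∣A′∣, so we have the inequality (1.14). It is the same as the inequality (55) [15]»); (1.15)–(1.16) p. 6 | D `B13Contraction113.QuadAnalytic`; T `B13Contraction113.bound_113`, `mapsTo_T`, `lipschitz_T`, `contraction_constant`, ★ `exists_unique_fixedPoint`, `bound_114`, `differentiableOn_fixedPoint`, `analytic_fixedPoint_113`, `fixedPoint_115` (the scheme of Sect. C [15] with (B₀, ε₃) ↦ (B₀e^{16κ₁}, ε₂), PROVED from Banach's fixed point theorem and Cauchy's estimate; the contraction condition 9C₂bε < 1 displayed — GAPS G-B13-02∕02a); T `B13Sect1Arith.radius_113`, `selfmap_113`, `two_eps2_114` («∣A∣ < ε₂ + B₀e^{16κ₁}4C₂ε₂² ≦ 2ε₂»,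 (57) [15]), `last_ineq_115`, `chain_115`, `norm_bound_115` | cited |
| B13.Eq1.5 | (1.5) p. 3 «the solutions D, 𝐀₀ can be considered as functional of these operators, having all the properties proved in [15]» | T `B13GaugeDevices.fixedPoint_cov`, `fixedPoint_cov₂`, `fixedPoint_cov_of_image` (covariance of the fixed points as functionals of the operators); `B13Contraction113` is parametric in the operator (`hHop`) | cited |
| B13.Eq1.6 ∕ B13.Eq1.7 | (1.6)–(1.7) p. 3 (the generalized random walk expansion (3.107) [13] and the bound (3.108) [13], «This bound holds for all operator norms in formulations of theorems in [13], e.g. in Theorem 3.1. The first two factors in (1.7) are used to control the sum over ω, and they determine the constant B₀») | H `B13Sect1Statements.Eq16`, `Ineq17`, **`Eq16_17`** (over the [13]-carriers `B9.Geometry`, `B9.Backgrounds`, `B9.RWExpansion`, factor `B9.walkFactor`); T `B13Sect1Statements.walkFactor_17`, ★ `eq16_17_of_thm310` ((1.6)–(1.7) ⇐ [13] Thm 3.10 as typed, `B9.Thm310Printed`), `sumControl_17` («determine the constant B₀», by `B9.walkSum_le`) | field `Hyp.walks`; `Hyp.eq16`, `Hyp.ineq17` |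
| B13.Def§1@3 | p. 3 ll. 25–36: the partition σ_k into R₁M₁-cubes («R₁ is a power of L satisfying the condition R₁M₁M⁻¹ ≦ 1»), σ₀, the parameters s(Δ), the s-dependent propagators («They coincide with the original ones for s = 1»), «The symbol B′ in (1.1) denotes the local function of B defined by (I.3.2)» | D `B13MayerDecoupling.corner`, `delta`, `Dop` (the decoupling calculus); D `B13Eq111SDecoupling.sTerm`, `sDecorate` with T `sTerm_one`, `sDecorate_one` (the s = 1 sentence PROVED), `jointWalkExpansion_sDecorate`; D `B13Sect1Statements.Bprime119` ∕ `B13Eq119BPrime.bPrime` ((I.3.2) = (1.19)) | cited |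
| B13.Eq1.9 ∕ B13.Eq1.10 ∕ B13.Def§1@4 | (1.9) p. 4 (the fundamental theorem of calculus in s); the connectedness of p. 4 (two cases: disjoint with □̃⁴ ∕ containing it; Y₀ = the component containing □̃⁴); the locality chain p. 4 l. 18 – p. 5 l. 3 («kernels of the operators H(s), G(s), H₀(s) vanish, unless both arguments are in the interior of one component of Y(σ) … D(H(s), A′) restricted to the interior of a component depends on A′, H(s), hence s, restricted to this component … 𝐀₀(H(s), G(s), H₀(s)B′) is equal to 0 on the neighborhood of Y(σ)ᶜ … the term … corresponding to the set σ, depends on propagators and function B, s restricted to the component Y₀ … If there are other components, then the derivatives with respect to s restricted to these components render the term equal to 0»); (1.10) | T `B13MayerDecoupling.decoupling_19`, `decoupling_19_integral`, `Dop_eq_zero_of_indep`, `Dop_eq_zero_of_indep_at`, ★ `decoupling_110`, `decoupling_110_integral`; D `B13MayerDecoupling.Linked`, `RelConnected`, `compY0` with T `relConnected_iff_compY0_eq`, `relConnected_compY0`, `linked_compY0`, `mem_compY0`; D `B13ScaleTransfer.FaceConnected` | cited |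
| B13.Eq1.11 | (1.11) p. 5 with «If m is big enough, for example m > 2⁴, then δ₀d(ω) ≧ δ₁mM, for a positive constant δ₁ depending on δ₀ only, and we can bound the expression under the supremum in (1.11) by 1, for δ₁M ≧ κ₁. If m ≦ 2⁴, then we can have short walks, in fact with ∣ω∣ = 0, and the expression can be bounded by e^{16κ₁} only. Thus the function H(s(Y₀))X is an analytic function of the variables s(Y₀) on the domain ∣s(Y₀)∣ ≦ e^{κ₁}, bounded by B₀e^{16κ₁}∣X∣ in all norms of Theorems 3.1.-3.10 [13]» | D `B13WalkCubes111.delta1` (T `delta1_pos`, `delta1_four`); T `B13WalkCubes111.ineq111_long`, `supFactor_le_one`, `supFactor_le_short`, `ineq111_repaired`, ★ `ineq111_repaired_four`, and the located DEFECT of the printed dichotomy T `printed111_counterexample`, `printed111_fails` (the cell's repaired cube count); T `B13Eq111SDecoupling.norm_sTerm_le`, `absorb_of_dichotomy`, `dichotomy_of_treeLength`, ★ `sDecorate_entry_le_R1` (the conclusion «bounded by B₀e^{16κ₁}∣X∣» PROVED on the joint-walk-expansion model from the two printed clauses) | cited |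
| B13.Eq1.12 | (1.12) p. 5 the change of variables 𝐀 = 𝐀′ − H(s(Y₀))D(H(s(Y₀)), 𝐀′) | D `B13GaugeDevices.solD` with T `solD_spec`, `solD_eq_of_exists`, `eq_solD_of_fix`, `norm_solD_le`, `solD_cov`; T `B13Eq117Hk.Hk_eq_changeOfVariables` | cited |
| (p. 5 l. 38 – p. 6 l. 2) | «This implies that the function V(H(s(Y₀)), A′), defined by (80) [15] with the help of the transformation (1.12), is an analytic function of A′, s(Y₀), and Proposition 4 [15] holds for it (with ε₃ replaced by ε₂) … The last propagators are analytic functions of s(Y₀), and they have the same bound (1.11) as H(s(Y₀))» | the DISPLAYED hypotheses `hW : QuadAnalytic W (C₄·b) R` ∕ `hHop` of T `B13Contraction113.fixedPoint_115` (its docstring: «(98) of Proposition 4 [15] for the s(Y₀)-dependent background» is a by-reference input, cell GAPS G-B13-01 ∕ G-IF-10); H `B11.Prop4Printed` ([15] Prop. 4 (97)–(98) itself) | cited (a by-reference input typed by name as a displayed hypothesis; not re-typed — a `def` aliasing `QuadAnalytic` would restate it) |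
| B13.Eq1.16 ∕ B13.Eq1.18 | (1.16) p. 6; (1.18) p. 6 «It is an analytic function of s(Y₀), B′, satisfying the bound ∣𝐇_k(s(Y₀), B′)∣ ≦ 4B₀e^{16κ₁}∣B′∣ < 4B₀e^{16κ₁}ε₃ ≦ 2ε₂» + «all the considered functions and operators are analytic functions of the configurations 𝐔, 𝐉 in a domain given by the conditions I.(i)–(iii) with some α′₀, α′₁, and all the bounds above are uniform on the domain» | T `B13Sect1Arith.chain_116`, `bound_118`, `tail_118`; T `B13Eq117Hk.ineq118`, `norm_xArg_lt`, `mapsTo_xArg`, `analyticOnNhd_Hk` (analyticity PROVED on the model); the uniformity sentence is the reader-owned `Analytic`∕`Uc` convention of `B13.StepData` and `B13Sect1Statements.OnDomain7` | cited |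
| B13.Eq1.19 ∕ B13.Eq1.20 | (1.19)–(1.20) p. 6 «B′ = g_kCB − hD̃(g_kCB) … ∣B′∣ ≦ O(1)g_k∣B∣ + 4C₂(O(1)g_k∣B∣)² ≦ C₁g_k∣B∣ < C₁ε₁, (1.20) where C₁ is an absolute constant, and g_k∣B∣ < ε₁» | D `B13Sect1Statements.Bprime119` with T `Bprime119_eq_phi`, `norm_Bprime119_le`, `norm_Bprime119_le_C₁`; D `B13Eq119BPrime.bPrime`, `psi1`, `C1` with T `ineq120`, `ineq120_printed_of_b_le_one`, `C1_eq`, `c₀_le_C1`, `norm_bPrime_le`; T `B13Sect1Arith.bound_120`, `lt_120`, `C₁_le_120` («absolute» presupposes 4C₂c₀ε₁ ≤ 1 — census R5, displayed) | cited |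
| B13.Eq1.21 ∕ B13.Eq1.22 | (1.21) p. 7 «𝐇_k(s(Y₀), B′) is an analytic function of s(Y₀), B, for ∣s(Y₀)∣ ≦ e^{κ₁} and g_k∣B∣ < ε₁. It has the estimate (1.21) … if e^{32κ₁}ε₁ is smaller than an absolute constant»; (1.22) p. 7 (the t_□-circle, after «We assume that 4B₀C₁e^{16κ₁}ε₁ ≦ ¼α₂ …») | T `B13Sect1Arith.bound_121`, ★ `inspection_121`, `eq_122`, `lt_122`, `radius_122_R7`, `radius_122_R7_sharp`; T `B13Eq117Hk.ineq121`; T `B13Eq119BPrime.constraint_bPrime` | cited |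
| B13.Eq1.23 ∕ B13.Eq1.24 ∕ B13.Eq1.25 | (1.23) p. 7 (the Cauchy representation over the circles ∣σ(Δ)∣ = e^{κ₁} and (1.22)); (1.24) («we estimate the above expression using (I.3.54)»); (1.25) («Adding and subtracting ⅛κ₁d_k(□₀) … where Y = Y₀ ∪ □₀. Of course Y is a localization domain from 𝐃_k») | D `B13Sect1Arith.cauchyOp` with T `norm_cauchy_t`, `norm_cauchy_sigma`, `norm_cauchyOp_le`, `cauchy_factor_le`, `cauchy_factor_pow_le`; T `B13Sect1Arith.bound_124` ((1.24) from its displayed inputs (I.3.54), (1.21)–(1.22)), `exponent_125`, `bound_125`; the Y ∈ 𝐃_k sentence: T `B13MayerDecoupling.relConnected_compY0` (Y₀ is connected relative to □̃⁴ ⊃ □₀) with the cube carriers `B13ScaleTransfer.FaceConnected`, `TreeLengthTorus.tsys` (𝐃_k = connected unions of cubes; the p. 7 sentence is quoted at `B13Sect1Arith.bound_125`) | cited |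
| B13.Txt@7 | p. 7 ll. 27–35 «Before considering such a sum we have to take a common domain of analyticity for all terms in it. From the results of Sect. I.3 it follows that the term (1.23) is an analytic function of configurations 𝐔, 𝐉, defined on the space U^c_{k+1}(□₀, (1+2β)α₀, (1+2β)α₁, α₀). By the construction it depends on 𝐔, 𝐉 restricted to Y₀ ∪ □₀ = Y, and the conditions outside Y are unessential. Thus we consider this space defined by the conditions I.(i)–(iii) on the domain Y, and we take its subspace U^c_{k+1}(Y, (1+β)α₀, (1+β)α₁, α₀). All terms (1.23) with the localization domain Y are defined and analytic on this space» | H `B13Sect1Statements.OnDomain7` (premise), H `B13Sect1Statements.CommonDomain7` (conclusion), T ★ `B13Sect1Statements.commonDomain7_of_onDomain` (premise ⇒ conclusion PROVED) | field `Hyp.onDomain7`; `Hyp.commonDomain7` |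
| (p. 7 l. 36 – p. 8) | «Now we consider the sum of all terms (1.23) having the same localization domain Y …» (1.26)–(1.28), Lemma 1 | block 28 (`B13Carve28Lemmas1to2Hyp`, carve-08 g4): H `B13Sect1Statements.Eq127` (T `Eq127_holds`), `Eq128`, `B13.Lemma1Printed`, T `B13Lemma1Assembly.lemma1Printed_of_sect1` | not this block |

## Census of the REMAINING printed sentences of pp. 1–7 (every sentence that asserts something)

* p. 1, abstract and Introduction ll. 13–29 — row B13.Main: cited; field `Hyp.main`.  ll. 14–18 («In the first paper of this series we
  have considered the fluctuation field integral … We have shown there that the fluctuation field effective action is a small perturbation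
  of the basic quadratic form, in the small field approximation») — a recap of [I] Sects. 2–5 (blocks 20–26; `B12.Thm3Printed`'s
  antecedents, `B13.smallFieldStep_of_parts`'s `PartI`): cited.  ll. 29–33 («The two expansions constructed here are quite general …
  can be, and will be, applied in many other situations») — a promise, quoted in `…B13`'s module docstring; its uses are [III] Sect. 3
  and [V] Sect. 1 (blocks 35, 38–40): no statement.
* p. 2 ll. 2–4 (reference conventions) — no statement.  ll. 6–16 («The newly created terms, after the cancellations described at the end
  of Sect. I.4, satisfy much better bounds of the type (I.0.29) … They are analytic and nonlocal functions of the configurations 𝐔, 𝐉, B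
  … Analyzing the terms (I.3.7), (I.3.21) or (I.3.34), we see that they have the following structure: there exists a function
  𝐄(X, 𝐔, 𝐉, 𝐀) analytic and localized to X in 𝐔, 𝐉, 𝐀, such that a given term is obtained substituting a proper nonlocal expression
  in the place of 𝐀») — a recap of [I] Sect. 3's RESULTS (the terms (I.3.7)∕(I.3.21)∕(I.3.34) with their analyticity: cell B12 rows
  B12.Eq3.7, 3.21, 3.34 — blocks 21–22 of this fan, not yet carved; in this paper's tree the structure is typed for the treated term as
  `B13Sect1Statements.A11` («E(□₀, 𝐔, 𝐀)» with the substituted argument) and, for the (I.3.7)-type terms, `B13PkScaling`): cited.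
  ll. 17–26 — row B13.Eq1.1 and the programme sentence («Our problem is to localize the obtained function, more precisely to represent
  it as a sum of terms, which are localized in domains from 𝐃_k, and which satisfy bounds of the type (I.1.18)» = what Lemma 1 (block 28)
  and `B13.Bound118` state): cited.  ll. 27–40 — rows B13.Eq1.2–1.4 and «V(A′) … given by the formula (80) [15]. Thus Eqs. (1.3), (1.4)
  are determined by local, analytic functions, and nonlocal propagators H, H₀, G» ([15] (80) = cell B11 `B11Eq81Expansion.*`; the
  local∕nonlocal split is the parametricity of `B13Contraction113` in `Hop`): cited.
* p. 3 ll. 2–6 — row B13.Eq1.5: cited.  ll. 7–24 — rows B13.Eq1.6–1.7 (incl. «We will use the remaining two factors to produce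
  exponential bounds for localized terms» = the rôle of `e^{−δ₀d}` in `B13Eq111SDecoupling.norm_sTerm_le`): cited; field `Hyp.walks`.
  ll. 25–36 — row B13.Def§1@3: cited.  ll. 37–41 ((1.8), the substituted term 𝐄(□₀, 𝐔, (tζ̃_□ + t_□ζ_□)𝐇_k(H, G, H₀, B′))) — a
  definition (`B13Sect1Statements.A11Hk`): cited.
* p. 4 (whole page) — rows B13.Eq1.9, B13.Def§1@4, B13.Eq1.10 with the locality chain: cited (`B13MayerDecoupling` §§ «Linked ∕
  RelConnected ∕ compY0», `decoupling_110`: the passage from (1.9) to (1.10) PROVED for functions with the displayed locality).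
* p. 5 ll. 1–3 («all propagators and the function B are restricted to Y₀. This implies that this term depends on 𝐔, 𝐉 restricted to
  Y₀ ∪ □₀») — the locality clause of `OnDomain7`'s premise («By the construction it depends on 𝐔, 𝐉 restricted to Y₀ ∪ □₀ = Y»):
  cited.  ll. 4–6 (the Cauchy-formula plan) — realized by (1.23), `B13Sect1Arith.cauchyOp`: cited.  ll. 7–20 — row B13.Eq1.11:
  cited (with the cell's located repair of the cube-count dichotomy, `printed111_fails` ∕ `ineq111_repaired_four`).  ll. 21–35 —
  rows B13.Eq1.12–1.14: cited.  ll. 36–43 — (57) [15], the Proposition-4 sentence, «The last propagators are analytic functions of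
  s(Y₀), and they have the same bound (1.11) as H(s(Y₀))» (table row «p. 5 l. 38 – p. 6 l. 2»): cited as displayed hypotheses.
* p. 6 ll. 1–15 — row B13.Eq1.15 with its two restrictions and «so the function satisfies the assumption of Proposition 4 in this
  case» (`B13Sect1Arith.norm_bound_115`, `last_ineq_115`; `B13Eq117Hk`'s docstring at (1.17)), (1.16): cited.  ll. 16–25 — rows
  B13.Eq1.17–1.18: cited.  ll. 26–31 — rows B13.Eq1.19–1.20: cited.  ll. 32–33 + p. 7 ll. 1–5 — row B13.Eq1.21 («Gathering together
  the above statements and estimates» = `B13Sect1Arith.bound_121`; the «inspection» sentence PROVED: `inspection_121`,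
  `inspection_121_contraction`): cited.
* p. 7 ll. 5–13 («We have yet another condition for the function 𝐇_k in (1.21), namely this function multiplied by tζ̃_□ + t_□ζ_□ has to
  satisfy the bounds (I.3.31). We assume that 4B₀C₁e^{16κ₁}ε₁ ≦ ¼α₂, and this implies that the product with tζ̃_□ satisfies (I.3.31) with
  ½α₂. The product with ζ_□ has the norms in (I.3.31) bounded by 4B₀C₁e^{16κ₁}g_k∣B∣ < 4B₀C₁e^{16κ₁}ε₁, and we extend the expression in
  (1.10) analytically with respect to t_□ satisfying ∣t_□∣4B₀C₁e^{16κ₁}g_k∣B∣ ≦ ½α₂. Taking t_□ for which the equality holds, we get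
  (1.22)») — row B13.Eq1.22: cited (`radius_122_R7`: R7 ⇒ the right side of (1.22) is ≥ 1, so the unit t_□-circle lies inside;
  `B13Eq119BPrime.constraint_bPrime`, `norm_Qop_T7_bPrime_le` for (I.3.31)).  ll. 14–26 — rows B13.Eq1.23–1.25 («We were doing all
  the considerations for the last term in (I.3.34), hence we estimate the above expression using (I.3.54)»; the ⅛κ₁d_k(□₀) manoeuvre;
  «Of course Y is a localization domain from 𝐃_k. The inequality (1.24) supplemented by the above bound is enough to control the sum over
  all terms (1.23) having a common localization domain Y» — the last sentence is the forward announcement of (1.26)–(1.29), block 28,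
  PROVED there as `B13Lemma1Assembly.bound129_of_levels`): cited.  ll. 27–35 — row B13.Txt@7: cited; field `Hyp.onDomain7`,
  `Hyp.commonDomain7`.  ll. 36–37 — block 28.

RESULT OF THE CENSUS: NO printed statement of pp. 1–7 lacks an in-tree home; the block's residual is EMPTY and this file types NO new
`…Printed` statement.  What the cell has LOCATED in this stretch travels with the cited names, never restated here: the cube-count
dichotomy behind (1.11) fails as printed and is repaired (`B13WalkCubes111.printed111_fails` ∕ `ineq111_repaired_four`); «We prove
similarly that it is contractive» needs the undisplayed contraction condition of [15]'s own proof, absorbed by p. 7's «inspection»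
(`B13Contraction113.contraction_constant`, `inspection_121_contraction`; GAPS G-B13-02a); (1.7), (1.11), (98) of Proposition 4 [15]
for the s-dependent background, and (I.3.54) are BY-REFERENCE inputs (GAPS G-B13-01…05) typed by name as hypotheses of the proved
schemes; «C₁ is an absolute constant» presupposes 4C₂c₀ε₁ ≤ 1 (census R5, `B13Sect1Arith.C₁_le_120`).

## What is here
* §1 `Hyp C E U A Cw cw M₁ δ₀ D Uc Analytic T loc α₀ α₁ β` — ONE `Prop`-valued structure conjoining BY NAME the block's hypothesis-form
  printed statements: `main` = the Introduction's claim («the terms of the expansion satisfy the inductive assumptions … Thus we complete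
  the proof of Theorem 3 of that paper»; `B13.SmallFieldStep (C P) P.K γ` for every run `P` of a small-field construction
  `C : B12.Construction`, under ONE window letter `γ > 0` chosen after the construction — [I] Thm 3's «sufficiently small positive γ … The
  constant γ depends on all other constants», the standing smallness DISPLAYED as the binder `∃ γ > 0` (RULING #9 (2))); `walks` =
  (1.6)–(1.7) for the operators H, G̃, H₀ (`B13Sect1Statements.Eq16_17 E U A Cw cw M₁ δ₀`, over the [13]-carriers: expansions
  `E o : B9.RWExpansion g bg`, background `U`, norm prefactor `A`, the two printed O(1) `Cw`, `cw`, the cube size `M₁`, the rate `δ₀`);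
  `onDomain7` = the p. 7 premise sentences (`B13Sect1Statements.OnDomain7 D Uc Analytic T loc α₀ α₁ β`, over the abstract domain
  system `D : LocDomainSys`, the spaces `Uc`, the reader-owned predicate `Analytic`, the terms (1.23) `T i` with localization `loc i`).
  Explicit carriers throughout; hypothesis slot only; nothing asserted.
* §2 kernel-checked bookkeeping out of `Hyp` (no statement asserted): `smallFieldStep_anti` (the Introduction's claim is antitone in the
  window letter), ★ `Hyp.indAssAll_of_base` — with the BASE of [I] Theorem 3's induction (the inductive assumptions of A₀ on the windowed
  runs, the hypothesis `h0` — [I] p. 264, block 19's row, not this paper's) the claim gives [I] Theorem 3's innermost clause «∀ k ≤ K,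
  the inductive assumptions hold» on every run in the window `min γ γ_b` (`B13.indAss_all`; = `Dag.Leaves.smallFieldInductive` under
  `smallCouplings` as bound by `DagBinding.leaves`, the leaf K2⁷'s node reads); `Hyp.eq16`, `Hyp.ineq17` (projections per operator);
  ★ `Hyp.commonDomain7` — the p. 7 conclusion `B13Sect1Statements.CommonDomain7` from the field `onDomain7` by the tree's
  `commonDomain7_of_onDomain` under its displayed structural hypotheses (restriction of analyticity to subsets, monotonicity of the spaces
  in the constants, 0 ≤ β, α₀, α₁).

## HONEST SCOPE — what is NOT claimed
Nothing of [II] is proved here and no `…Printed` statement is asserted: `Hyp` is a HYPOTHESIS bundle; the theorems are bookkeeping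
between typed shapes (a `min` of two windows, an induction already in the tree, a restriction of analyticity domains).  The
Introduction's claim is the NODE N10 of the cell's DAG (`Dag.B13_main`): its printed proof is the whole paper (Lemmas 1–3, blocks 28–30)
together with [I] Sects. 2–5; taking `(h : Hyp …)` is taking that node as a hypothesis — this fan's contract (CARVE-RULES §2.4–2.5),
not a discharge.  With carriers chosen freely the bundle is SATISFIABLE BY DEGENERATE DATA in part (an empty operator index `O` or term
index `ι` makes `walks`∕`onDomain7` vacuous; a construction whose `IndAss` is constantly `True` makes `main` trivial) — it earns its
keep only at Bałaban's objects (the cell's NODE 00 record and the [13]-family `B9.Thm310Printed` quantifies over), not typed here.  No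
summit statement is proved by this seat; K2⁷ ∕ nodes N09–N10 are NOT discharged; the file moves no node count; one lattice paper at
finite K — nothing continuum ∕ ℝ⁴ ∕ OS ∕ mass-gap ∕ Clay.  No `sorry`, no `instance`, no `notation`, no attribute manipulation;
imports `…B13Sect1Statements` (hence `…B13Sect1Arith`, `…B13Eq117Hk`, `…B9`) and `…B13` (hence `…B12`, `…Setup`) only.
-/

namespace Literature.MathematicalPhysics.QuantumFieldTheory.Balaban1983to89.B13Carve27Sect1LocalizationsHyp

open Literature.MathematicalPhysics.QuantumFieldTheory.Balaban1983to89

/-! ## §1 The block-27 hypothesis bundle -/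

/-- **BLOCK 27 OF [II] AS ONE HYPOTHESIS BUNDLE** (pp. 1–7 [PDF 1–7]): the printed statements of the block that the tree carries in
hypothesis form, conjoined BY NAME over their in-tree carriers —
`main` = **the Introduction's claim, p. 1** (*«The fluctuation field integral, constructed in Part I, is represented by the exponentiated
cluster expansion. It is proved that the terms of the expansion satisfy the inductive assumptions. This completes the construction of
the sequence of effective actions in the small field approximation.»*; *«We prove also that terms of this expansion satisfy the
inductive assumptions formulated in the first paper. Thus we complete the proof of Theorem 3 of that paper.»*; p. 22 *«The above remark
completes the proof of the inductive assumptions for the action A_{k+1}, hence the proof of Theorem I.3.»* — in tree `B13.SmallFieldStep`: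
for every run, for k < K, the inductive assumptions (1.1)–(1.22) of [I] for A_k and couplings 0 < g_j ≦ γ, j ≦ k + 1, give them for
A_{k+1}; here for every run `P` of the construction `C`, under ONE window letter γ > 0 chosen after the construction, [I] Thm 3 p. 264
*«with a sufficiently small positive γ … The constant γ depends on all other constants»* displayed as the binder `∃ γ > 0`);
`walks` = **(1.6)–(1.7) p. 3** (*«A propagator is represented by the sum (3.107) [13] Σ_ω R₀(X₀)R_{α₁}(X₁)⋯R_{αₙ}(Xₙ), (1.6) … The term
corresponding to a walk ω in (1.6) can be bounded, as (3.108) [13], by O(1)O(M₁^{−1∕2})^{∣ω∣}M₁^{−½∣ω∣}exp(−δ₀d(ω, y, y′)), (1.7) … This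
bound holds for all operator norms in formulations of theorems in [13]»* — in tree `B13Sect1Statements.Eq16_17`, for the operators
*«H, H₀, G̃»* of (1.5) indexed by `o : O`);
`onDomain7` = **p. 7 ll. 27–33** (*«From the results of Sect. I.3 it follows that the term (1.23) is an analytic function of
configurations 𝐔, 𝐉, defined on the space U^c_{k+1}(□₀, (1+2β)α₀, (1+2β)α₁, α₀). By the construction it depends on 𝐔, 𝐉 restricted to
Y₀ ∪ □₀ = Y, and the conditions outside Y are unessential. Thus we consider this space defined by the conditions I.(i)–(iii) on the
domain Y»* — in tree `B13Sect1Statements.OnDomain7`; its printed consequence *«All terms (1.23) with the localization domain Y are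
defined and analytic on this space»* is `Hyp.commonDomain7` below).
The other displays of the block ((1.1)–(1.5), (1.8)–(1.25)) are DEFINITIONS, by-reference inputs displayed as hypotheses of proved
schemes, or estimates PROVED in the sibling modules of the module docstring's table, and take no slot.  Explicit carriers: the
small-field construction `C : B12.Construction` (runs `P : B12.RunParams`); the [13]-carriers `g : B9.Geometry`, `bg : B9.Backgrounds`,
the expansions `E : O → B9.RWExpansion g bg`, the background `U : bg.Cfg`, the norm prefactor `A`, the constants `Cw cw M₁ δ₀` of (1.7);
the domain system `D : LocDomainSys` (𝐃_k with d_k), the spaces `Uc` (U^c_{k+1}(X, a₀, a₁, a₂) of [I] (3.16)), the reader-owned predicate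
`Analytic`, the terms (1.23) `T : ι → Φ → ℂ` with localization domains `loc`, the constants `α₀ α₁ β`.  Hypothesis slot only; nothing
asserted. [cite: Balaban1988RG2Cluster, abstract + Introduction p.1, (1.6)-(1.7) p.3, p.7 (after (1.25)); p.22] -/
structure Hyp (C : B12.Construction)
    {g : B9.Geometry} {bg : B9.Backgrounds} {O : Type} (E : O → B9.RWExpansion g bg) (U : bg.Cfg) (A : g.Site → ℝ)
    (Cw cw M₁ δ₀ : ℝ)
    {ι Φ : Type} (D : LocDomainSys) (Uc : D.Dom → ℝ → ℝ → ℝ → Set Φ) (Analytic : (Φ → ℂ) → Set Φ → Prop)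
    (T : ι → Φ → ℂ) (loc : ι → D.Dom) (α₀ α₁ β : ℝ) : Prop where
  /-- The Introduction's claim (p. 1; p. 22) along every run of the construction, one window letter — in tree: `B13.SmallFieldStep`. -/
  main : ∃ γ : ℝ, 0 < γ ∧ ∀ P : B12.RunParams, B13.SmallFieldStep (C P) P.K γ
  /-- (1.6)–(1.7) p. 3 for the operators of (1.5) — in tree: `B13Sect1Statements.Eq16_17`. -/
  walks : B13Sect1Statements.Eq16_17 E U A Cw cw M₁ δ₀
  /-- p. 7 ll. 27–33, the analyticity domains of the terms (1.23) — in tree: `B13Sect1Statements.OnDomain7`. -/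
  onDomain7 : B13Sect1Statements.OnDomain7 D Uc Analytic T loc α₀ α₁ β

/-! ## §2 Bookkeeping (kernel-checked uses of the cited declarations; no statement asserted) -/

/-- The Introduction's claim in the form `B13.SmallFieldStep D K γ` is ANTITONE in the window letter: a smaller window asks the step of
fewer runs∕coupling histories (`Flow.InInterval` is monotone in γ). [cite: Balaban1988RG2Cluster, p.22 (proof of Thm I.3) (bookkeeping)] -/
theorem smallFieldStep_anti (Dr : B12.RunData) (K : ℕ) {γ γ' : ℝ} (hle : γ' ≤ γ)
    (h : B13.SmallFieldStep Dr K γ) : B13.SmallFieldStep Dr K γ' :=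
  fun k hk hg hA => h k hk (fun j hj => ⟨(hg j hj).1, (hg j hj).2.trans hle⟩) hA

section Proj

variable {C : B12.Construction} {g : B9.Geometry} {bg : B9.Backgrounds} {O : Type} {E : O → B9.RWExpansion g bg}
  {U : bg.Cfg} {A : g.Site → ℝ} {Cw cw M₁ δ₀ : ℝ} {ι Φ : Type} {D : LocDomainSys} {Uc : D.Dom → ℝ → ℝ → ℝ → Set Φ}
  {Analytic : (Φ → ℂ) → Set Φ → Prop} {T : ι → Φ → ℂ} {loc : ι → D.Dom} {α₀ α₁ β : ℝ}

/-- ★ **[I] Theorem 3's innermost clause along the windowed runs, from the Introduction's claim and the base of the induction**: if on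
every run whose couplings lie in a window ]0, γ_b] the action A₀ satisfies the inductive assumptions of [I] (the base — [I] p. 264
*«Let us now suppose that the starting density e^{−A₀} is given either by Wilson action … or … satisfies all the above assumptions»*,
block 19's row, supplied by the consumer as `h0`), then on every run in the window `min γ γ_b` all the inductive assumptions hold for
every k ≦ K — `B13.indAss_all` (the same bookkeeping as `DagBinding.smallField_of_B13step` ∕ `B13.thm3_inner_of_step`), i.e. the leaf
`Dag.Leaves.smallFieldInductive` under `smallCouplings`. [cite: Balaban1988RG2Cluster, p.1 and p.22; Balaban1987RG1, Thm 3 p.264 (bookkeeping)] -/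
theorem Hyp.indAssAll_of_base (h : Hyp C E U A Cw cw M₁ δ₀ D Uc Analytic T loc α₀ α₁ β) {γb : ℝ} (hγb : 0 < γb)
    (h0 : ∀ P : B12.RunParams, (C P).flow.InInterval γb P.K → (C P).IndAss 0) :
    ∃ γ : ℝ, 0 < γ ∧ ∀ P : B12.RunParams, (C P).flow.InInterval γ P.K → ∀ k, k ≤ P.K → (C P).IndAss k := by
  obtain ⟨γ, hγ, hstep⟩ := h.main
  refine ⟨min γ γb, lt_min hγ hγb, fun P hP k hk => ?_⟩
  have hPb : (C P).flow.InInterval γb P.K := fun j hj => ⟨(hP j hj).1, (hP j hj).2.trans (min_le_right _ _)⟩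
  exact B13.indAss_all (C P) P.K (min γ γb) (h0 P hPb) (smallFieldStep_anti (C P) P.K (min_le_left _ _) (hstep P)) hP k hk

/-- **(1.6) p. 3** for the operator `o` — the expansion converges at the background — projected from the field `walks`.
[cite: Balaban1988RG2Cluster, (1.6) p.3 (bookkeeping)] -/
theorem Hyp.eq16 (h : Hyp C E U A Cw cw M₁ δ₀ D Uc Analytic T loc α₀ α₁ β) (o : O) :
    B13Sect1Statements.Eq16 (E o) U :=
  (h.walks o).1

/-- **(1.7) p. 3** for the operator `o` — locality of the walk terms and the printed walk-factor bound — projected from the field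
`walks`. [cite: Balaban1988RG2Cluster, (1.7) p.3 (bookkeeping)] -/
theorem Hyp.ineq17 (h : Hyp C E U A Cw cw M₁ δ₀ D Uc Analytic T loc α₀ α₁ β) (o : O) :
    B13Sect1Statements.Ineq17 (E o) U A Cw cw M₁ δ₀ :=
  (h.walks o).2

/-- ★ **p. 7, the conclusion «All terms (1.23) with the localization domain Y are defined and analytic on this space
[U^c_{k+1}(Y, (1+β)α₀, (1+β)α₁, α₀)]»** (`B13Sect1Statements.CommonDomain7`) from the field `onDomain7`, by the tree's
`B13Sect1Statements.commonDomain7_of_onDomain` under its displayed structural hypotheses: analyticity restricts to subsets (`hres`),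
the spaces U^c_{k+1}(X, a₀, a₁, a₂) grow with a₀, a₁ (`hmono`), and 0 ≦ β, α₀, α₁. [cite: Balaban1988RG2Cluster, p.7 (after (1.25)) (bookkeeping)] -/
theorem Hyp.commonDomain7 (h : Hyp C E U A Cw cw M₁ δ₀ D Uc Analytic T loc α₀ α₁ β)
    (hres : ∀ (f : Φ → ℂ) (s t : Set Φ), s ⊆ t → Analytic f t → Analytic f s)
    (hmono : ∀ (X : D.Dom) (a₀ a₀' a₁ a₁' a₂ : ℝ), a₀ ≤ a₀' → a₁ ≤ a₁' → Uc X a₀ a₁ a₂ ⊆ Uc X a₀' a₁' a₂)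
    (hβ : 0 ≤ β) (hα₀ : 0 ≤ α₀) (hα₁ : 0 ≤ α₁) :
    B13Sect1Statements.CommonDomain7 D Uc Analytic T loc α₀ α₁ β :=
  B13Sect1Statements.commonDomain7_of_onDomain D Uc Analytic T loc α₀ α₁ β hres hmono hβ hα₀ hα₁ h.onDomain7

end Proj

end Literature.MathematicalPhysics.QuantumFieldTheory.Balaban1983to89.B13Carve27Sect1LocalizationsHyp
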